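import Summits.PneNP.PneNP.Theses.SymmetryBudget
import Literature.Computability.Complexity.SymmetricCircuit
import Literature.Computability.Complexity.CircuitComposition
import Literature.Computability.Complexity.NegationElimination
import Literature.Computability.Complexity.CircuitRestriction
import Literature.Computability.Complexity.ThresholdGadgets
import Summits.PneNP.PneNP.Theorems.SymmetryBudgetWindowBarrierStubHeaderHardwiring

/-!
# `WindowBarrier` (stmt-PneNP-2145) — negative-side support III: symmetric probe-count circuits

Route `PneNP/SymmetryBudget`, crux rank 4 (`Summit.PneNP.PneNP.Theses.SymmetryBudget.WindowBarrier`;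
inline `Sym`/`HasSym`/`Bud` = `Circuit.IsSymmetricUnder` / `HasSymCircuit tcBasis` /
`pointStabiliserBudget` of `Literature.Computability.Complexity.SymmetricCircuit`, by `Iff.rfl`).
Sorry-free, by the crux disprover (cdisprove seat, cycle 2); companion of
`Negative/InvarianceAndBridge.lean`, `Negative/BudgetZero.lean`; used by
`Negative/ProbeCountTargets.lean` (necessary conditions on the fooling pairs of the picked line's
stub `stub_symmetricIndistinguishability`).

A reusable family of SYMMETRIC threshold circuits in the tree's straight-line model
(`Literature.Computability.Complexity.Circuit`), with its semantics and its symmetry checked: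

* `probeCircuit P t` — for a probe family `P : Fin n → Fin r → ι` over any type `ι` of input
  variables (index `c` reads the `r` inputs `P c 0, …, P c (r-1)`; for the crux, `ι = Fin m × Fin m`,
  matrix entries): the program `[∧₀, ∨₀] ++ [∧ᵣ of the probes of c, c < n] ++
  [MAJ_{2n+2t}(the n probe gates, 1^n, 0^{2t})]`, over `tcBasis`, of size `n + 3`
  (`size_probeCircuit`, `probeCircuit_isOver`).
* `probeCircuit_eval` — it computes `x ↦ [t ≤ probeCount P x]`, `probeCount P x = #{c | ∀ k, x (P c k)}`
  (gate equations via `getD_transcript_eq_gateValue`; the count via `numOnes_eq_countP_ofFn`).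
* `probeCircuit_isInducedAut` / `probeCircuit_isSymmetricUnder` — if a variable map `π` (for the
  crux: the diagonal action `ρ × ρ` of `ρ ∈ Γ`) permutes the indices by some `θ` compatibly
  (`π ∘ P c = P (θ c)` position by position), then `π` extends to the automorphism "`θ` on the probe
  gates, constants and counting gate fixed" (the argument multiset of the counting gate is permuted by
  `θ`: `Equiv.Perm.ofFn_comp_perm`).
* `hasSymCircuit_probeCount` — hence `HasSymCircuit tcBasis Γ (n + 3) (fun x => [t ≤ probeCount P x])`
  for every `Γ`-equivariant probe family: counting statistics over any affordable orbit of gate indices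
  (vertices `n = m`, ordered pairs `n = m²`, …) are symmetric-cheap. Folklore in substance
  (Anderson–Dawar 2017 §2: symmetric circuits evaluate counting terms); new as checked API.
-/

namespace Summit.PneNP.WindowBarrier.Negative

open scoped Classical
open Literature.Computability.Complexity Literature.Computability.Complexity.GateList
open Summit.PneNP.PneNP.Theorems.HeaderHardwiring

section ProbeCount

variable {ι : Type*} {n r : ℕ}

/-- The `∧ᵣ` gate reading the `r` probe wires `P c 0, …, P c (r-1)` attached to the index `c` (a
vertex, `n = m`, or a pair of vertices, `n = m²`, …). -/
def probeGate (P : Fin n → Fin r → ι) (c : Fin n) : Gate ι :=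
  ⟨r, (GateFn.and r).2, fun k => Sum.inl (P c k)⟩

/-- Arguments of the counting gate: the `n` probe gates (indices `2 … n+1`), then `n` copies of
the constant `true` (gate `0`) and `2t` copies of the constant `false` (gate `1`). -/
def majArgs (ι : Type*) (n t : ℕ) : Fin (n + (n + 2 * t)) → ι ⊕ ℕ :=
  Fin.append (fun a : Fin n => Sum.inr ((a : ℕ) + 2))
    (Fin.append (fun _ : Fin n => Sum.inr 0) (fun _ : Fin (2 * t) => Sum.inr 1))

/-- The counting gate `MAJ_{2n+2t}(probes, 1^n, 0^{2t})`: true iff at least `t` probes fire. -/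
def majGate (ι : Type*) (n t : ℕ) : Gate ι :=
  ⟨n + (n + 2 * t), (GateFn.maj (n + (n + 2 * t))).2, majArgs ι n t⟩

/-- The probe-count program `[∧₀, ∨₀] ++ [probe gates] ++ [counting gate]`. -/
def probeGates (P : Fin n → Fin r → ι) (t : ℕ) : List (Gate ι) :=
  [constGate _ true, constGate _ false] ++ List.ofFn (probeGate P) ++ [majGate ι n t]

/-- The probe-count program has `n + 3` gates. -/
theorem length_probeGates (P : Fin n → Fin r → ι) (t : ℕ) :
    (probeGates P t).length = n + 3 := by
  simp only [probeGates, List.length_append, List.length_cons, List.length_nil, List.length_ofFn]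
  omega

/-- Where the arguments of the counting gate point. -/
theorem majArgs_cases (ι : Type*) (n t : ℕ) (i : Fin (n + (n + 2 * t))) :
    (∃ a : Fin n, majArgs ι n t i = Sum.inr ((a : ℕ) + 2)) ∨ majArgs ι n t i = Sum.inr 0 ∨
      majArgs ι n t i = Sum.inr 1 := by
  induction i using Fin.addCases with
  | left a => exact Or.inl ⟨a, by simp [majArgs]⟩
  | right i =>
    induction i using Fin.addCases with
    | left b => exact Or.inr (Or.inl (by simp [majArgs]))
    | right c => exact Or.inr (Or.inr (by simp [majArgs]))

/-- The probe-count program is well formed. -/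
theorem wf_probeGates (P : Fin n → Fin r → ι) (t : ℕ) : WF (probeGates P t) := by
  refine WF.append (WF.append ?_ ?_) ?_
  · exact (WF.singleton (gateOK_constGate 0 true)).append_singleton (gateOK_constGate 1 false)
  · intro j g hj a k hk
    obtain ⟨a', ha'⟩ : ∃ a', probeGate P a' = g := List.mem_ofFn.1 (List.mem_iff_getElem?.2 ⟨j, hj⟩)
    subst ha'
    simp [probeGate] at hk
  · intro j g hj a k hk
    obtain ⟨rfl, rfl⟩ : j = 0 ∧ majGate ι n t = g := by simpa [List.getElem?_singleton] using hj
    change majArgs ι n t a = Sum.inr k at hk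
    simp only [List.length_append, List.length_cons, List.length_nil, List.length_ofFn]
    rcases majArgs_cases ι n t a with ⟨b, hb⟩ | hb | hb <;> rw [hb] at hk <;>
      simp only [Sum.inr.injEq] at hk <;> omega

/-- **The probe-count circuit** of the probe family `P` at threshold `t`. -/
def probeCircuit (P : Fin n → Fin r → ι) (t : ℕ) : Circuit ι :=
  toCircuit (probeGates P t) (Sum.inr (n + 2)) (wf_probeGates P t) (fun k hk => by
    rw [length_probeGates]
    have := Sum.inr.inj hk
    omega)

/-- The probe-count circuit has `n + 3` gates. -/
theorem probeCircuit_length (P : Fin n → Fin r → ι) (t : ℕ) :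
    (probeCircuit P t).gates.length = n + 3 :=
  length_probeGates P t

/-- The size of the probe-count circuit is `n + 3`. -/
theorem size_probeCircuit (P : Fin n → Fin r → ι) (t : ℕ) :
    (probeCircuit P t).size = n + 3 :=
  length_probeGates P t

/-- Gate `0` is the constant `true`. -/
theorem probeCircuit_getElem_zero (P : Fin n → Fin r → ι) (t : ℕ)
    (h : 0 < (probeCircuit P t).gates.length) : (probeCircuit P t).gates[0] = constGate _ true := by
  rfl

/-- Gate `1` is the constant `false`. -/
theorem probeCircuit_getElem_one (P : Fin n → Fin r → ι) (t : ℕ)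
    (h : 1 < (probeCircuit P t).gates.length) : (probeCircuit P t).gates[1] = constGate _ false := by
  rfl

/-- Gate `a + 2` is the probe gate of index `a`. -/
theorem probeCircuit_getElem_probe (P : Fin n → Fin r → ι) (t : ℕ) (a : ℕ) (ha : a < n)
    (h : a + 2 < (probeCircuit P t).gates.length) :
    (probeCircuit P t).gates[a + 2] = probeGate P ⟨a, ha⟩ := by
  show (probeGates P t)[a + 2] = _
  simp only [probeGates]
  rw [List.getElem_append_left (by simp; omega), List.getElem_append_right (by simp)]
  simp

/-- Gate `n + 2` is the counting gate. -/
theorem probeCircuit_getElem_maj (P : Fin n → Fin r → ι) (t : ℕ)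
    (h : n + 2 < (probeCircuit P t).gates.length) : (probeCircuit P t).gates[n + 2] = majGate ι n t := by
  show (probeGates P t)[n + 2] = _
  simp only [probeGates]
  rw [List.getElem_append_right (by simp)]
  simp

/-- The probe-count circuit is a threshold circuit (`∧₀, ∨₀, ∧ᵣ ∈ acBasis`, `MAJ ∈ tcBasis`). -/
theorem probeCircuit_isOver (P : Fin n → Fin r → ι) (t : ℕ) :
    (probeCircuit P t).IsOver tcBasis := by
  intro g hg
  change g ∈ [constGate _ true, constGate _ false] ++ List.ofFn (probeGate P) ++ [majGate ι n t] at hg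
  rcases List.mem_append.1 hg with hg | hg
  · rcases List.mem_append.1 hg with hg | hg
    · simp only [List.mem_cons, List.not_mem_nil, or_false] at hg
      rcases hg with rfl | rfl
      · exact acBasis_subset_tcBasis (const_mem_acBasis true)
      · exact acBasis_subset_tcBasis (const_mem_acBasis false)
    · obtain ⟨a, rfl⟩ := List.mem_ofFn.1 hg
      exact acBasis_subset_tcBasis (and_mem_acBasis r)
  · rw [List.mem_singleton] at hg
    subst hg
    exact maj_mem_tcBasis _

/-- The number of indices all of whose probes fire. -/
def probeCount (P : Fin n → Fin r → ι) (x : ι → Bool) : ℕ :=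
  GateFn.numOnes fun a : Fin n => decide (∀ k : Fin r, x (P a k) = true)

/-- Gate equations of the probe-count circuit. -/
theorem probeCircuit_getD (P : Fin n → Fin r → ι) (t : ℕ) (x : ι → Bool)
    (j : ℕ) (hj : j < (probeCircuit P t).gates.length) :
    (vals (probeCircuit P t).gates x).getD j false =
      gateValue x (vals (probeCircuit P t).gates x) ((probeCircuit P t).gates[j]) := by
  have h1 : vals (probeCircuit P t).gates x = transcript x [] (probeCircuit P t).gates :=
    (circuit_wireVals (probeCircuit P t) x).symm.trans (wireVals_eq_transcript _ x)
  rw [h1]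
  exact getD_transcript_eq_gateValue (probeCircuit P t) x j hj

/-- **Semantics**: the probe-count circuit decides `t ≤ #{a | all probes of a fire}`. -/
theorem probeCircuit_eval (P : Fin n → Fin r → ι) (t : ℕ) (x : ι → Bool) :
    (probeCircuit P t).eval x = decide (t ≤ probeCount P x) := by
  have hlen : (probeCircuit P t).gates.length = n + 3 := length_probeGates P t
  have h0 : (vals (probeCircuit P t).gates x).getD 0 false = true := by
    rw [probeCircuit_getD P t x 0 (by omega), probeCircuit_getElem_zero]
    rfl
  have h1 : (vals (probeCircuit P t).gates x).getD 1 false = false := by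
    rw [probeCircuit_getD P t x 1 (by omega), probeCircuit_getElem_one]
    rfl
  have hprobe : ∀ a : Fin n, (vals (probeCircuit P t).gates x).getD ((a : ℕ) + 2) false =
      decide (∀ k : Fin r, x (P a k) = true) := by
    intro a
    rw [probeCircuit_getD P t x _ (by omega), probeCircuit_getElem_probe P t a a.2 (by omega)]
    rfl
  have hmaj : (vals (probeCircuit P t).gates x).getD (n + 2) false =
      decide (n + (n + 2 * t) ≤ 2 * GateFn.numOnes fun i =>
        wireVal x (vals (probeCircuit P t).gates x) (majArgs ι n t i)) := by
    rw [probeCircuit_getD P t x _ (by omega), probeCircuit_getElem_maj P t (by omega)]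
    rfl
  have hb1 : GateFn.numOnes (fun a : Fin n =>
      wireVal x (vals (probeCircuit P t).gates x) (Sum.inr ((a : ℕ) + 2))) = probeCount P x := by
    unfold probeCount
    congr 1
    funext a
    exact hprobe a
  have hb2 : (List.ofFn fun _ : Fin n => (Sum.inr 0 : ι ⊕ ℕ)).countP
      (fun w => wireVal x (vals (probeCircuit P t).gates x) w) = n := by
    rw [List.countP_eq_length.2 (fun w hw => ?_), List.length_ofFn]
    obtain ⟨i, rfl⟩ := List.mem_ofFn.1 hw
    exact h0
  have hb3 : (List.ofFn fun _ : Fin (2 * t) => (Sum.inr 1 : ι ⊕ ℕ)).countP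
      (fun w => wireVal x (vals (probeCircuit P t).gates x) w) = 0 := by
    rw [List.countP_eq_zero]
    intro w hw
    obtain ⟨i, rfl⟩ := List.mem_ofFn.1 hw
    show ¬ ((vals (probeCircuit P t).gates x).getD 1 false = true)
    rw [h1]
    exact Bool.false_ne_true
  have hcount : GateFn.numOnes (fun i => wireVal x (vals (probeCircuit P t).gates x) (majArgs ι n t i)) =
      probeCount P x + n := by
    rw [Circuit.numOnes_eq_countP_ofFn (wireVal x (vals (probeCircuit P t).gates x)) (majArgs ι n t),
      majArgs, List.ofFn_fin_append, List.ofFn_fin_append, List.countP_append, List.countP_append,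
      ← Circuit.numOnes_eq_countP_ofFn (wireVal x (vals (probeCircuit P t).gates x))
        (fun a : Fin n => (Sum.inr ((a : ℕ) + 2) : ι ⊕ ℕ)),
      hb1, hb2, hb3, Nat.add_zero]
  rw [circuit_eval]
  show wireOf x (vals (probeCircuit P t).gates x) (Sum.inr (n + 2)) = _
  rw [wireOf_inr, hmaj, hcount]
  exact (decide_eq_decide).2 ⟨fun h => by omega, fun h => by omega⟩

/-- A permutation of `Fin n` extended to `Fin (n + 1)` by fixing the last index. -/
theorem exists_fixLastPerm (ρ : Equiv.Perm (Fin n)) :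
    ∃ ρ' : Equiv.Perm (Fin (n + 1)), ∀ k : ℕ,
      Circuit.relabelGate ρ' k = if k < n then Circuit.relabelGate ρ k else k := by
  have hlt : ∀ (θ : Equiv.Perm (Fin n)) {v : ℕ}, v < n + 1 →
      (if v < n then Circuit.relabelGate θ v else v) < n + 1 := by
    intro θ v hv
    split_ifs with h
    · exact (Circuit.relabelGate_lt θ h).trans (Nat.lt_succ_self n)
    · exact hv
  have hinv : ∀ (θ : Equiv.Perm (Fin n)) {v : ℕ}, v < n + 1 →
      (if (if v < n then Circuit.relabelGate θ v else v) < n then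
          Circuit.relabelGate θ.symm (if v < n then Circuit.relabelGate θ v else v)
        else (if v < n then Circuit.relabelGate θ v else v)) = v := by
    intro θ v hv
    by_cases h : v < n
    · simp only [if_pos h, if_pos (Circuit.relabelGate_lt θ h)]
      exact relabelGate_symm_relabelGate θ h
    · simp only [if_neg h]
  refine ⟨⟨fun i => ⟨if (i : ℕ) < n then Circuit.relabelGate ρ i else i, hlt ρ i.2⟩,
    fun i => ⟨if (i : ℕ) < n then Circuit.relabelGate ρ.symm i else i, hlt ρ.symm i.2⟩,
    fun i => Fin.ext (hinv ρ i.2),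
    fun i => Fin.ext (by simpa only [Equiv.symm_symm] using hinv ρ.symm i.2)⟩, fun k => ?_⟩
  by_cases hk : k < n + 1
  · rw [Circuit.relabelGate_of_lt _ hk]
    rfl
  · have h1 : ¬ k < n := by omega
    rw [Circuit.relabelGate_of_le _ (not_lt.1 hk), if_neg h1]

/-- The gate permutation of the probe-count circuit induced by a vertex permutation `ρ`:
it fixes the two constants and the counting gate and moves probe gate `a` to probe gate `ρ a`. -/
theorem exists_probePerm {N : ℕ} (hN : N = n + 3) (θ : Equiv.Perm (Fin n)) :
    ∃ τ : Equiv.Perm (Fin N), (∀ k, k < 2 → Circuit.relabelGate τ k = k) ∧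
      (∀ a : Fin n, Circuit.relabelGate τ ((a : ℕ) + 2) = (θ a : ℕ) + 2) ∧
      Circuit.relabelGate τ (n + 2) = n + 2 := by
  obtain ⟨ρ', hρ'⟩ := exists_fixLastPerm θ
  obtain ⟨τ, hτ⟩ := exists_liftPerm 2 (by omega : N = (n + 1) + 2) ρ'
  refine ⟨τ, fun k hk => by rw [hτ, if_pos hk], fun a => ?_, ?_⟩
  · rw [hτ, if_neg (by omega), Nat.add_sub_cancel, hρ', if_pos a.2, Circuit.relabelGate_of_lt θ a.2]
  · rw [hτ, if_neg (by omega), Nat.add_sub_cancel, hρ', if_neg (lt_irrefl n)]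

/-- **Symmetry**: if the probe family is equivariant under a map `π` of the input variables and a
permutation `θ` of the indices (`π` carries the probes of `c` to the probes of `θ c`, position by
position), then `π` extends to an automorphism of the probe-count circuit (`θ` on the probe
gates; the constants and the counting gate are fixed). -/
theorem probeCircuit_isInducedAut (P : Fin n → Fin r → ι) (t : ℕ)
    (π : ι → ι) (θ : Equiv.Perm (Fin n)) (hP : ∀ (a : Fin n) (k : Fin r), π (P a k) = P (θ a) k) :
    ∃ τ : Equiv.Perm (Fin (probeCircuit P t).gates.length), (probeCircuit P t).IsInducedAut π τ := by
  have hlen : (probeCircuit P t).gates.length = n + 3 := length_probeGates P t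
  obtain ⟨τ, hτ2, hτa, hτm⟩ := exists_probePerm hlen θ
  refine ⟨τ, ?_, ?_⟩
  · show Circuit.relabelWire _ τ (Sum.inr (n + 2)) = Sum.inr (n + 2)
    rw [Circuit.relabelWire_inr, hτm]
  · rintro ⟨j, hj⟩
    simp only [Fin.getElem_fin]
    have hj3 : j < n + 3 := hlen ▸ hj
    have hjv : ((τ ⟨j, hj⟩ : Fin _) : ℕ) = Circuit.relabelGate τ j :=
      (Circuit.relabelGate_of_lt τ hj).symm
    rcases Nat.lt_or_ge j 2 with hj2 | hj2
    · -- a constant gate: fixed, no arguments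
      have hv : ((τ ⟨j, hj⟩ : Fin _) : ℕ) = j := by rw [hjv, hτ2 j hj2]
      rw [getElem_congr_idx hv]
      refine ⟨rfl, ?_⟩
      interval_cases j
      · rw [probeCircuit_getElem_zero,
          List.ofFn_eq_nil_iff.2 (rfl : (constGate ι true).arity = 0), List.map_nil]
      · rw [probeCircuit_getElem_one,
          List.ofFn_eq_nil_iff.2 (rfl : (constGate ι false).arity = 0), List.map_nil]
    rcases Nat.lt_or_ge j (n + 2) with hjm | hjm
    · -- probe gate `a + 2` goes to probe gate `θ a + 2`
      obtain ⟨a, rfl⟩ : ∃ a, j = a + 2 := ⟨j - 2, by omega⟩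
      have ha : a < n := by omega
      have hv : ((τ ⟨a + 2, hj⟩ : Fin _) : ℕ) = (θ ⟨a, ha⟩ : ℕ) + 2 := by rw [hjv, hτa ⟨a, ha⟩]
      rw [getElem_congr_idx hv]
      rw [probeCircuit_getElem_probe P t _ (θ ⟨a, ha⟩).2, probeCircuit_getElem_probe P t a ha]
      refine ⟨rfl, ?_⟩
      rw [List.map_ofFn]
      refine List.Perm.of_eq (congrArg List.ofFn (funext fun k => ?_))
      show (Sum.inl (P (θ ⟨a, ha⟩) k) : ι ⊕ ℕ) = Sum.inl (π (P ⟨a, ha⟩ k))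
      rw [hP]
    · -- the counting gate: fixed; its probe arguments are permuted by `θ`
      have hjm' : j = n + 2 := by omega
      subst hjm'
      have hv : ((τ ⟨n + 2, hj⟩ : Fin _) : ℕ) = n + 2 := by rw [hjv, hτm]
      rw [getElem_congr_idx hv]
      rw [probeCircuit_getElem_maj]
      refine ⟨rfl, ?_⟩
      show (List.ofFn (majArgs ι n t)).Perm ((List.ofFn (majArgs ι n t)).map (Circuit.relabelWire π τ))
      rw [majArgs, List.ofFn_fin_append, List.ofFn_fin_append, List.map_append, List.map_append,
        List.map_ofFn, List.map_ofFn, List.map_ofFn]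
      refine List.Perm.append ?_ (List.Perm.of_eq ?_)
      · have hb1 : (Circuit.relabelWire π τ ∘ fun a : Fin n => (Sum.inr ((a : ℕ) + 2) : ι ⊕ ℕ)) =
            (fun a : Fin n => (Sum.inr ((a : ℕ) + 2) : ι ⊕ ℕ)) ∘ θ := by
          funext a
          simp only [Function.comp_apply, Circuit.relabelWire_inr, hτa a]
        rw [hb1]
        exact (Equiv.Perm.ofFn_comp_perm θ _).symm
      · congr 1
        · refine congrArg List.ofFn (funext fun b => ?_)
          simp only [Function.comp_apply, Circuit.relabelWire_inr, hτ2 0 (by norm_num)]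
        · refine congrArg List.ofFn (funext fun c => ?_)
          simp only [Function.comp_apply, Circuit.relabelWire_inr, hτ2 1 (by norm_num)]

/-- Hence the probe-count circuit is `Γ`-symmetric for every `Γ` under which the probe family is
equivariant (every `ρ ∈ Γ` permutes the indices by some `θ` compatibly with its diagonal action on
the probe wires). -/
theorem probeCircuit_isSymmetricUnder {m : ℕ} (P : Fin n → Fin r → Fin m × Fin m) (t : ℕ)
    (Γ : Set (Equiv.Perm (Fin m)))
    (hP : ∀ ρ ∈ Γ, ∃ θ : Equiv.Perm (Fin n), ∀ (a : Fin n) (k : Fin r),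
      (ρ (P a k).1, ρ (P a k).2) = P (θ a) k) :
    (probeCircuit P t).IsSymmetricUnder Γ := fun ρ hρ => by
  obtain ⟨θ, hθ⟩ := hP ρ hρ
  exact probeCircuit_isInducedAut P t (fun q : Fin m × Fin m => (ρ q.1, ρ q.2)) θ hθ

/-- **Probe counts are symmetric-cheap**: for an equivariant probe family, `x ↦ [t ≤ #{c | all
probes of c fire on x}]` has a `Γ`-symmetric threshold circuit with `n + 3` gates. -/
theorem hasSymCircuit_probeCount {m : ℕ} (P : Fin n → Fin r → Fin m × Fin m) (t : ℕ)
    (Γ : Set (Equiv.Perm (Fin m)))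
    (hP : ∀ ρ ∈ Γ, ∃ θ : Equiv.Perm (Fin n), ∀ (a : Fin n) (k : Fin r),
      (ρ (P a k).1, ρ (P a k).2) = P (θ a) k) :
    HasSymCircuit tcBasis Γ (n + 3) (fun x => decide (t ≤ probeCount P x)) :=
  ⟨probeCircuit P t, probeCircuit_isOver P t, (size_probeCircuit P t).le,
    probeCircuit_isSymmetricUnder P t Γ hP, probeCircuit_eval P t⟩

end ProbeCount

end Summit.PneNP.WindowBarrier.Negative
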